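import Mathlib
import HarnessLib
import Summits.ValiantsHypothesis.ValiantsHypothesis.Theses.MonotoneRestoration
import Literature.Computability.AlgebraicComplexity.ArithCircuit
import Literature.Computability.AlgebraicComplexity.ArithCircuitProofs
import Literature.Computability.AlgebraicComplexity.MonotoneStructure
import Literature.Computability.AlgebraicComplexity.PermanentIrreducible
import Literature.ModelTheory.FiniteModelTheory.CkEquiv
import Summits.ValiantsHypothesis.ValiantsHypothesis.Theorems.MonotoneRestorationMonotoneRestorationQPCosetCount
import Summits.ValiantsHypothesis.ValiantsHypothesis.Theorems.MonotoneRestorationMonotoneRestorationQPSymmetricLB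
import Summits.ValiantsHypothesis.ValiantsHypothesis.Theorems.MonotoneRestorationMonotoneRestorationQPSupportSymmetrisation
import Summits.ValiantsHypothesis.ValiantsHypothesis.Theorems.MonotoneRestorationMonotoneRestorationQPSparseRegime
import Summits.ValiantsHypothesis.ValiantsHypothesis.Theorems.MonotoneRestorationMonotoneRestorationQPBeta
import Literature.Computability.AlgebraicComplexity.SymmetricArithCircuit
import Literature.Computability.AlgebraicComplexity.DawarWilsenach2025Proofs
import Literature.GroupTheory.PermutationGroups.SmallIndexSubgroups
import Summits.ValiantsHypothesis.ValiantsHypothesis.Theorems.MonotoneRestorationQP.Negative.LoadBearing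
import Summits.ValiantsHypothesis.ValiantsHypothesis.Theorems.MonotoneRestorationMonotoneRestorationQPPermSupportCount

/-! TTRL-lite variant V19036 of stmt-ValiantsHypothesis-15886

`[diag_injective]` (move `lemma_proposal`): each diagonal renaming
`q ↦ rename (p ↦ (ρ p.1, ρ p.2)) q` of `MvPolynomial (Fin n × Fin n) K` is injective — the
have-step giving distinctness of orbit elements in `stub_altFixing_orbit_dichotomy`. -/

set_option linter.dupNamespace false

namespace Summit.ValiantsHypothesis.ValiantsHypothesis.Theorems

open Summit.ValiantsHypothesis.ValiantsHypothesis.Theses.MonotoneRestoration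
open Literature.Computability.AlgebraicComplexity

/-- TTRL-lite variant V19036 (`[diag_injective]`): for every permutation `ρ` of `Fin n`, the
diagonal renaming `q ↦ MvPolynomial.rename (fun p => (ρ p.1, ρ p.2)) q` on
`MvPolynomial (Fin n × Fin n) K` is injective. Immediate from `MvPolynomial.rename_injective`,
since `p ↦ (ρ p.1, ρ p.2)` is injective (`ρ` is a bijection). -/
theorem stub_altFixing_orbit_dichotomy_var19036 :
    ∀ (n : ℕ) (K : Type) [CommSemiring K] (ρ : Equiv.Perm (Fin n)),
      Function.Injective (fun q : MvPolynomial (Fin n × Fin n) K =>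
        MvPolynomial.rename (fun p : Fin n × Fin n => (ρ p.1, ρ p.2)) q) := by
  intro n K _ ρ
  refine MvPolynomial.rename_injective _ ?_
  intro p p' h
  simp only [Prod.mk.injEq, EmbeddingLike.apply_eq_iff_eq] at h
  exact Prod.ext h.1 h.2

end Summit.ValiantsHypothesis.ValiantsHypothesis.Theorems
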